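import Summits.PneNP.Statement
import Summits.PneNP.PneNP.Theses.ExpanderLinearGenerators
import Summits.PneNP.PneNP.Theorems.ProofCplxAssembly
import Literature.Computability.Complexity.ProofComplexityNP
import Literature.Computability.Complexity.NondeterministicProofs
import Literature.Computability.Complexity.ClayProblem
import Literature.Computability.Complexity.ClayProblemProofs
import Literature.Computability.Complexity.Classes

/-!
# PneNP / ExpanderLinearGenerators — `TautBridge` (item `stmt-PneNP-10249`)

The support item `TautBridge` of route `ExpanderLinearGenerators` (shared verbatim with routes
`LyapunovRefutations`, `AperiodicTorus`, `MatroidTseitin`, and the assembly of `ProofCplx`):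

  `¬ HasPolyBoundedProofSystem TAUT → PneNP`.

Proof (Cook–Reckhow 1979, Prop. 1.1 with Prop. 1.4; Arora–Barak 2009, §2.6.1): by the tree's
Cook–Reckhow equivalence `NP_eq_coNP_iff_hasPolyBoundedProofSystem_TAUT_holds`
(`NP = coNP ↔ HasPolyBoundedProofSystem TAUT`, proved in
`Literature/Computability/Complexity/ProofComplexityNP.lean`) the hypothesis gives `NP ≠ coNP`,
and the assembly theorem `Literature.CplxMeta.proofcplx_assembly`
(`Summits/PneNP/PneNP/Theorems/ProofCplxAssembly.lean`) turns `NP ≠ coNP` into `PneNP` given the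
four named facts `P_subset_NP`, `P_bool_eq`, `NP_bool_eq`, `co_P`, all of which are discharged in
the tree (`P_subset_NP_holds`, `P_bool_eq_holds`, `NP_bool_eq_holds`, `co_P_holds`). The result is
therefore unconditional (axioms `propext`, `Classical.choice`, `Quot.sound`).
-/

namespace Summit.PneNP.PneNP.Theorems

/-- **`TautBridge`** (item `stmt-PneNP-10249` of route `ExpanderLinearGenerators`): if `TAUT` has
no polynomially bounded Cook–Reckhow proof system then `P ≠ NP` (Cook's form `PneNP`).
If `P = NP` then `coNP = co P = P = NP`, so `TAUT ∈ coNP = NP` would have a polynomially bounded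
proof system (Cook–Reckhow 1979, Prop. 1.1/1.4). Assembled from
`NP_eq_coNP_iff_hasPolyBoundedProofSystem_TAUT_holds` and `Literature.CplxMeta.proofcplx_assembly`
with its four named-fact hypotheses discharged. [cite: CookReckhow1979, §1 Prop. 1.1] -/
theorem tautBridge_proof : Summit.PneNP.PneNP.Theses.ExpanderLinearGenerators.TautBridge := by
  unfold Summit.PneNP.PneNP.Theses.ExpanderLinearGenerators.TautBridge
  intro hX
  exact Literature.CplxMeta.proofcplx_assembly
    Literature.Computability.Complexity.P_subset_NP_holds
    Literature.Computability.Complexity.P_bool_eq_holds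
    Literature.Computability.Complexity.NP_bool_eq_holds
    Literature.Computability.Complexity.co_P_holds
    (fun heq =>
      hX (Literature.Computability.Complexity.NP_eq_coNP_iff_hasPolyBoundedProofSystem_TAUT_holds.1
        heq))

end Summit.PneNP.PneNP.Theorems
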